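import Mathlib.LinearAlgebra.Matrix.GeneralLinearGroup.Card
import Mathlib.FieldTheory.IntermediateField.Adjoin.Basic
import Mathlib.Analysis.SpecialFunctions.Log.Basic
import Mathlib.Analysis.Complex.ExponentialBounds
import Mathlib.Analysis.Real.Pi.Bounds
import Mathlib.Algebra.Field.ZMod
import HarnessLib

/-!
# Joshi, *Arithmetic Teichmüller Spaces IV* (arXiv:2403.10430v2) §6.3 «Easy lemmata» 6.3.1–6.3.4 — PROVED

Record file of the abc-iut cell, branch E (rung LADDER-ABC:A2.E; seat abc-iut-E-t30, slot T-30; companion of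
`Joshi/ATS4MainBounds.lean`). [J-IV] p.58 l.44–45: «6.3 Easy lemmata. The proofs of the following Lemmata are well-known
or trivial.» Every item of §6.3 is a classical statement and is PROVED here from Mathlib (DERIVABLE rows of
plan/E/t30/INVENTORY.tsv, discharged); nothing is typed as a hypothesis. Also proved: the two numerical USES the proofs of
Lemmas 6.4.1 / 6.4.2 make of Lemma 6.3.2 (p.59 l.31 «[L : L_tpd] ≤ 2·(2⁴·3)·(2⁵·3·5) = 2¹⁰·3²·5»; p.60 l.26–27 «[L′ : L] ≤ ℓ⁴
by Lemma 6.3.2», i.e. `|GL₂(F_ℓ)| ≤ ℓ⁴`). Locators: render `HOME/lit/renders/Joshi-arxiv-2403.10430/pNNNN.txt`, «p.N l.M».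

* Lem 6.3.1 (p.58 l.46 – p.59 l.5): «(1) For any integer n ≥ 1, Σ_{j=1}^n j = n(n+1)/2. (2) … Σ_{j=1}^n j² = n(n+1)(2n+1)/6.»
* Lem 6.3.2 (p.59 l.6–11): «For any prime number p, one has |GL₂(F_p)| = p·(p+1)·(p−1)². Especially (1) |GL₂(F₂)| = 2·3,
  (2) |GL₂(F₃)| = 2⁴·3, (3) |GL₂(F₅)| = 2⁵·3·5.» (Mathlib: `Matrix.card_GL_field`.)
* Lem 6.3.3 (p.59 l.12–15): «Evidently [L_mod(√−1) : L_mod] ≤ 2» — proved for every field extension `E/K` and every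
  `i ∈ E` with `i² = −1` (the number field `L_mod` is E-t26's carrier; nothing about it is needed).
* Lem 6.3.4 (p.59 l.16–18): «(1) 0 < log(2) ≤ 1, (2) 1 ≤ log(3) < log(π) ≤ log(5) ≤ 2.»

No side taken on [IUTchIII] Cor. 3.12 or on any author; the source is an unrefereed preprint, but the mathematics of
§6.3 is classical and undisputed — the tag [claim: Joshi2024ATS4, status: disputed] below marks only the TRANSCRIPTION
of the printed statements. Standard axioms only.
-/

noncomputable section

namespace Summit.ABC.IUTFork.Joshi.ATS4

open Finset

/-! ## Lemma 6.3.1 -/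

/-- **Lem 6.3.1 (1)** ([J-IV] p.58 l.47–51): «For any integer n ≥ 1, one has Σ_{j=1}^n j = n·(n+1)/2» (cleared of the
denominator; true for `n = 0` as well). PROVED. [claim: Joshi2024ATS4, status: disputed] -/
theorem lem631_1 (n : ℕ) : (∑ j ∈ Icc 1 n, j) * 2 = n * (n + 1) := by
  induction n with
  | zero => simp
  | succ n ih =>
    rw [Finset.sum_Icc_succ_top (by omega), add_mul, ih]
    ring

/-- Lem 6.3.1 (1) in the printed form `Σ_{j=1}^n j = n(n+1)/2` (exact division in `ℕ`). PROVED.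
[claim: Joshi2024ATS4, status: disputed] -/
theorem lem631_1_div (n : ℕ) : ∑ j ∈ Icc 1 n, j = n * (n + 1) / 2 := by
  have h := lem631_1 n
  omega

/-- **Lem 6.3.1 (2)** ([J-IV] p.59 l.1–5): «For any integer n ≥ 1, one has Σ_{j=1}^n j² = n·(n+1)(2n+1)/6» (cleared of
the denominator). PROVED. [claim: Joshi2024ATS4, status: disputed] -/
theorem lem631_2 (n : ℕ) : (∑ j ∈ Icc 1 n, j ^ 2) * 6 = n * (n + 1) * (2 * n + 1) := by
  induction n with
  | zero => simp
  | succ n ih =>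
    rw [Finset.sum_Icc_succ_top (by omega), add_mul, ih]
    ring

/-- Lem 6.3.1 (2) in the printed form `Σ_{j=1}^n j² = n(n+1)(2n+1)/6` (exact division in `ℕ`). PROVED.
[claim: Joshi2024ATS4, status: disputed] -/
theorem lem631_2_div (n : ℕ) : ∑ j ∈ Icc 1 n, j ^ 2 = n * (n + 1) * (2 * n + 1) / 6 := by
  have h := lem631_2 n
  omega

/-! ## Lemma 6.3.2 -/

/-- `|GL₂(𝔽)| = q(q+1)(q−1)²` for a finite field with `q` elements (Mathlib's `Matrix.card_GL_field`:
`|GL_n(𝔽_q)| = ∏_{i<n} (qⁿ − qⁱ)`, at `n = 2`: `(q²−1)(q²−q)`). [folklore] -/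
theorem card_GL_two (𝔽 : Type*) [Field 𝔽] [Fintype 𝔽] :
    Nat.card (GL (Fin 2) 𝔽) = Fintype.card 𝔽 * (Fintype.card 𝔽 + 1) * (Fintype.card 𝔽 - 1) ^ 2 := by
  rw [Matrix.card_GL_field 2, Fin.prod_univ_two]
  simp only [Fin.val_zero, Fin.val_one, pow_zero, pow_one]
  have hpos : 0 < Fintype.card 𝔽 := Fintype.card_pos
  generalize Fintype.card 𝔽 = q at hpos ⊢
  obtain ⟨k, rfl⟩ : ∃ k, q = k + 1 := ⟨q - 1, by omega⟩
  have e1 : (k + 1) ^ 2 - 1 = k * (k + 2) := Nat.sub_eq_of_eq_add (by ring)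
  have e2 : (k + 1) ^ 2 - (k + 1) = (k + 1) * k := Nat.sub_eq_of_eq_add (by ring)
  rw [e1, e2, Nat.add_sub_cancel]
  ring

/-- **Lem 6.3.2** ([J-IV] p.59 l.6–7): «For any prime number p, one has |GL₂(F_p)| = p·(p+1)·(p−1)².» PROVED.
[claim: Joshi2024ATS4, status: disputed] -/
theorem lem632 (p : ℕ) [Fact p.Prime] : Nat.card (GL (Fin 2) (ZMod p)) = p * (p + 1) * (p - 1) ^ 2 := by
  have h := card_GL_two (ZMod p)
  rw [ZMod.card p] at h
  exact h

/-- **Lem 6.3.2 (1)** (p.59 l.9): «|GL₂(F₂)| = 2·3». PROVED. [claim: Joshi2024ATS4, status: disputed] -/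
theorem lem632_1 : Nat.card (GL (Fin 2) (ZMod 2)) = 2 * 3 := by
  rw [lem632]; norm_num

/-- **Lem 6.3.2 (2)** (p.59 l.10): «|GL₂(F₃)| = 2⁴·3». PROVED. [claim: Joshi2024ATS4, status: disputed] -/
theorem lem632_2 : Nat.card (GL (Fin 2) (ZMod 3)) = 2 ^ 4 * 3 := by
  rw [lem632]; norm_num

/-- **Lem 6.3.2 (3)** (p.59 l.11): «|GL₂(F₅)| = 2⁵·3·5». PROVED. [claim: Joshi2024ATS4, status: disputed] -/
theorem lem632_3 : Nat.card (GL (Fin 2) (ZMod 5)) = 2 ^ 5 * 3 * 5 := by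
  haveI : Fact (Nat.Prime 5) := ⟨Nat.prime_five⟩
  rw [lem632]; norm_num

/-- USE of Lem 6.3.2 in the proof of Lem 6.4.1 (p.59 l.31): «2·(2⁴·3)·(2⁵·3·5) = 2¹⁰·3²·5», i.e.
`2·|GL₂(F₃)|·|GL₂(F₅)| = 2¹⁰·3²·5 (= 46080)`. PROVED. [claim: Joshi2024ATS4, status: disputed] -/
theorem two_mul_card_GL_three_mul_card_GL_five :
    2 * Nat.card (GL (Fin 2) (ZMod 3)) * Nat.card (GL (Fin 2) (ZMod 5)) = 2 ^ 10 * 3 ^ 2 * 5 := by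
  rw [lem632_2, lem632_3]; norm_num

/-- USE of Lem 6.3.2 in the proof of Lem 6.4.2 (p.60 l.26–27): «[L′ : L] ≤ ℓ⁴ by Lemma 6.3.2», i.e. `p(p+1)(p−1)² ≤ p⁴`
(for every `p ≥ 1`; `(p+1)(p−1)² = (p²−1)(p−1) ≤ p³`). PROVED. [claim: Joshi2024ATS4, status: disputed] -/
theorem card_GL_two_formula_le_pow_four (p : ℕ) : p * (p + 1) * (p - 1) ^ 2 ≤ p ^ 4 := by
  rcases Nat.eq_zero_or_pos p with rfl | hp
  · simp
  obtain ⟨k, rfl⟩ : ∃ k, p = k + 1 := ⟨p - 1, by omega⟩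
  rw [Nat.add_sub_cancel]
  nlinarith [sq_nonneg k]

/-- Hence `|GL₂(F_ℓ)| ≤ ℓ⁴` for every prime `ℓ`. PROVED. [claim: Joshi2024ATS4, status: disputed] -/
theorem lem632_le_pow_four (p : ℕ) [Fact p.Prime] : Nat.card (GL (Fin 2) (ZMod p)) ≤ p ^ 4 := by
  rw [lem632]; exact card_GL_two_formula_le_pow_four p

/-! ## Lemma 6.3.3 -/

/-- **Lem 6.3.3** ([J-IV] p.59 l.12–15): «Evidently [L_mod(√−1) : L_mod] ≤ 2» — for every field extension `E/K` and every
`i ∈ E` with `i² = −1`, `[K(i) : K] ≤ 2` (the minimal polynomial of `i` divides `X² + 1`). PROVED.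
[claim: Joshi2024ATS4, status: disputed] -/
theorem lem633 (K E : Type*) [Field K] [Field E] [Algebra K E] (i : E) (hi : i ^ 2 = -1) :
    Module.finrank K (IntermediateField.adjoin K {i}) ≤ 2 := by
  have hp : (Polynomial.X ^ 2 + Polynomial.C (1 : K)).Monic := Polynomial.monic_X_pow_add_C 1 two_ne_zero
  have hroot : Polynomial.aeval i (Polynomial.X ^ 2 + Polynomial.C (1 : K)) = 0 := by
    simp [hi]
  have hint : IsIntegral K i := ⟨_, hp, by rw [← Polynomial.aeval_def]; exact hroot⟩
  rw [IntermediateField.adjoin.finrank hint]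
  calc (minpoly K i).natDegree ≤ (Polynomial.X ^ 2 + Polynomial.C (1 : K)).natDegree :=
        Polynomial.natDegree_le_natDegree (minpoly.min K i hp hroot)
    _ = 2 := Polynomial.natDegree_X_pow_add_C

/-! ## Lemma 6.3.4 -/

/-- **Lem 6.3.4 (1)** ([J-IV] p.59 l.17): «0 < log(2) ≤ 1». PROVED. [claim: Joshi2024ATS4, status: disputed] -/
theorem lem634_1 : 0 < Real.log 2 ∧ Real.log 2 ≤ 1 := by
  refine ⟨Real.log_pos one_lt_two, ?_⟩
  have := Real.log_two_lt_d9
  linarith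

/-- **Lem 6.3.4 (2)** ([J-IV] p.59 l.18): «1 ≤ log(3) < log(π) ≤ log(5) ≤ 2» (`e < 3 < π ≤ 4 < 5 ≤ e²`). PROVED.
[claim: Joshi2024ATS4, status: disputed] -/
theorem lem634_2 :
    1 ≤ Real.log 3 ∧ Real.log 3 < Real.log Real.pi ∧ Real.log Real.pi ≤ Real.log 5 ∧ Real.log 5 ≤ 2 := by
  have he := Real.exp_one_lt_d9
  -- `5 ≤ e²` (the tree has this as `Literature.NumberTheory.LFunctions.NumberField.five_le_exp_two_real`, in a module
  -- too heavy to import here)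
  have h5 : (5 : ℝ) ≤ Real.exp 2 := by
    have he' := Real.exp_one_gt_d9
    have e2 : Real.exp 2 = Real.exp 1 * Real.exp 1 := by rw [← Real.exp_add]; norm_num
    rw [e2]; nlinarith
  refine ⟨?_, ?_, ?_, ?_⟩
  · calc (1 : ℝ) = Real.log (Real.exp 1) := (Real.log_exp 1).symm
      _ ≤ Real.log 3 := Real.log_le_log (Real.exp_pos 1) (by linarith)
  · exact Real.log_lt_log (by norm_num) Real.pi_gt_three
  · exact Real.log_le_log Real.pi_pos (by linarith [Real.pi_le_four])
  · calc Real.log 5 ≤ Real.log (Real.exp 2) := Real.log_le_log (by norm_num) h5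
      _ = 2 := Real.log_exp 2

end Summit.ABC.IUTFork.Joshi.ATS4

end
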